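import Mathlib
import HarnessLib
import Summits.HubbardSuperconductivity.HubbardSuperconductivity.Theorems.KLProgrammeKLRegimeWickOrderedStep
import Summits.HubbardSuperconductivity.HubbardSuperconductivity.Theorems.KLProgrammeKLRegimeTwoPointAssemblyConservation
import Summits.HubbardSuperconductivity.HubbardSuperconductivity.Theorems.KLProgrammeKLRegimeVolumeLimitDefs
import Summits.HubbardSuperconductivity.HubbardSuperconductivity.Theorems.KLProgrammeKLRegimeSplitThermalLayer
import Literature.MathematicalPhysics.QuantumLattice.HubbardSectorCovariance

/-!
# Route `KLProgramme` — ENGINE child stmt-HubbardSuperconductivity-20236 `KLRegimeEngineV16`, `stub_engine_step_norms` / `stub_engine_step_values`: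
# the RADIAL ALIGNMENT of the sector multipliers against the engine's covariances, kernel-checked (the table of SECTOR-RADIAL-ALIGNMENT.md,
# evidence #13 on 20236)

Cell gate-hubbard-kl, seat hubbard-kl-k3c2-p3 (g4, row «sector-counting import (DR2000 L11/L12) for the leg-dress bar»).  In the variable
`t = √(ω_k² + e_K(k⃗)²)` (`e_K = nambuXiCT L μ K`, `Λ_j = klScale e₀ j = e₀·4^{-j}`):

* §1 the thin family `klAnisoFamily … e₀ n` (`= bgmMultiplier`, radial factor `gnScaleCutoff 4 e₀ (−n)`): **`sum_klAnisoFamily_eq_one_of_le`**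
  (`t ≤ Λ_{n+1} ⇒ Σ_ω F_ω(k) = 1`), **`klAnisoFamily_eq_zero_of_le`** (`Λ_n ≤ t ⇒ F_ω(k) = 0`), and on the annulus in between the partition is
  STRICTLY partial: `sum_klAnisoFamily_lt_one_of_lt` (`Λ_{n+1} < t ⇒ Σ_ω F_ω(k) < 1`); the fat family `bgmFatMultiplier … n` vanishes for
  `Λ_{n−1} ≤ t` (`bgmFatMultiplier_eq_zero_of_le`, `1 ≤ n`);
* §2 the covariances of the engine (`klE0`): the soft covariance `klSoftCov n = C − C_{>Λ_n}` vanishes at entries with a leg at `t ≥ Λ_n`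
  (`klSoftCov_apply_eq_zero_of_le`), and IS a slice: **`klSoftCov_eq_hubbardCovSliceCT`** (`= C^K_{(Λₛ, Λ_n]}` for every `0 < Λₛ ≤ π/β`, since
  `|ω_k| ≥ π/β` makes the weight at `Λₛ` identically `1`), in particular `klSoftCov_eq_sliceCT_nScales_succ` (`Λₛ = Λ_{n_β+1} < π/β`) — so every
  sector-counting bound stated for `hubbardCovSliceCT … Λ Λ′` with `Λ` free (…SectorSliceGram / …SectorSliceGramRegime) covers the soft lines too;
* §3 the `hsupp` door: if the kernels of `G` vanish unless every leg has `t ≤ Λ_{n+1}`, then `G` satisfies the support hypothesis of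
  `hubbardSectorKernelNorm_effAction_le_of_sectorNorm` / `map_sectorSub_sectorPreimage` for `F = klAnisoFamily … n` (`hsupp_klAnisoFamily_of_support`).

Consequence recorded in the memo (not re-derived here): an input coupling to `supp klSoftCov n = {t < Λ_n}` needs `F = klAnisoFamily k` with
`k ≤ n−1`.  Everything is proved; no definitions, no named facts.  [cite: BenfattoGiulianiMastropietro2006, §2.2 (2.9), §2.5 (2.45)–(2.48)]
-/

noncomputable section

namespace Summit.HubbardSuperconductivity.HubbardSuperconductivity.Theorems.KLRegimeWick

set_option linter.dupNamespace false -- summit = problem name (single-conjunct summit), D-0017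

open Real Finset Literature.MathematicalPhysics.QuantumLattice Literature.Probability.LatticeModels
open Summit.HubbardSuperconductivity.HubbardSuperconductivity.Theorems.KLProgrammeLegKernels
open Summit.HubbardSuperconductivity.HubbardSuperconductivity.Theorems.KLRegimeSplit
open Summit.HubbardSuperconductivity.HubbardSuperconductivity.Theorems.TwoPointAssembly

section Multipliers

variable {L M : ℕ} {e₀ : ℝ} (β μ : ℝ) (K : TrigPolyC4v)

/-- `Λ_{n+1} = e₀·4^{(−n) − 1}` in the integer-exponent form of `gnScaleCutoff_eq_one`. -/
theorem klScale_succ_eq_zpow (e₀ : ℝ) (n : ℕ) : klScale e₀ (n + 1) = e₀ * (4 : ℝ) ^ ((-(n : ℤ)) - 1) := by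
  rw [klScale, show (-(n : ℤ)) - 1 = -((n + 1 : ℕ) : ℤ) by push_cast; ring, zpow_neg, zpow_natCast]

/-- `Λ_n = e₀·4^{−n}` in the integer-exponent form of `gnScaleCutoff_eq_zero`. -/
theorem klScale_eq_zpow (e₀ : ℝ) (n : ℕ) : klScale e₀ n = e₀ * (4 : ℝ) ^ (-(n : ℤ)) := by
  rw [klScale, zpow_neg, zpow_natCast]

/-- **The thin family is a complete partition of unity on `t ≤ Λ_{n+1}`**: `Σ_ω klAnisoFamily … n ω k = 1`.
[cite: BenfattoGiulianiMastropietro2006, §2.5 (2.45)] -/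
theorem sum_klAnisoFamily_eq_one_of_le (he : 0 < e₀) (n : ℕ) (k : FreqMomentum L M)
    (hk : Real.sqrt (matsubaraFreq β M k.1 ^ 2 + nambuXiCT L μ K k.2 ^ 2) ≤ klScale e₀ (n + 1)) :
    ∑ ω, klAnisoFamily L M β μ K e₀ n ω k = 1 := by
  rw [klAnisoFamily, sum_bgmMultiplier, gnScaleCutoff_eq_one (by norm_num) he, Complex.ofReal_one]
  rwa [← klScale_succ_eq_zpow e₀]

/-- **The thin family vanishes at `t ≥ Λ_n`**: `klAnisoFamily … n ω k = 0`. [cite: BenfattoGiulianiMastropietro2006, §2.5 (2.45)] -/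
theorem klAnisoFamily_eq_zero_of_le (he : 0 < e₀) (n : ℕ) (ω : Fin (sectorCount n)) (k : FreqMomentum L M)
    (hk : klScale e₀ n ≤ Real.sqrt (matsubaraFreq β M k.1 ^ 2 + nambuXiCT L μ K k.2 ^ 2)) :
    klAnisoFamily L M β μ K e₀ n ω k = 0 := by
  rw [klAnisoFamily, bgmMultiplier, gnScaleCutoff_eq_zero (by norm_num) he (by rwa [← klScale_eq_zpow e₀]), zero_mul, Complex.ofReal_zero]

/-- **On the annulus `Λ_{n+1} < t` the partition is strictly partial**: `Σ_ω klAnisoFamily … n ω k` is a real number `< 1`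
(and it is `0` from `t ≥ Λ_n` on). [cite: BenfattoGiulianiMastropietro2006, §2.2 (2.9)] -/
theorem sum_klAnisoFamily_lt_one_of_lt (he : 0 < e₀) (n : ℕ) (k : FreqMomentum L M)
    (hk : klScale e₀ (n + 1) < Real.sqrt (matsubaraFreq β M k.1 ^ 2 + nambuXiCT L μ K k.2 ^ 2)) :
    ∃ r : ℝ, r < 1 ∧ ∑ ω, klAnisoFamily L M β μ K e₀ n ω k = (r : ℂ) := by
  refine ⟨gnScaleCutoff 4 e₀ (-(n : ℤ)) (Real.sqrt (matsubaraFreq β M k.1 ^ 2 + nambuXiCT L μ K k.2 ^ 2)), ?_, ?_⟩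
  · rw [gnScaleCutoff, gnCutoff]
    apply Real.smoothTransition.lt_one_of_lt_one
    have hden : 0 < e₀ * (1 - (4 : ℝ)⁻¹) := by positivity
    rw [div_lt_one hden, zpow_neg, zpow_neg, inv_inv, zpow_natCast]
    rw [klScale] at hk
    have h4 : (0 : ℝ) < (4 : ℝ) ^ n := by positivity
    have : e₀ * ((4 : ℝ) ^ n)⁻¹ * (4 : ℝ) ^ n / 4 < Real.sqrt (matsubaraFreq β M k.1 ^ 2 + nambuXiCT L μ K k.2 ^ 2) * (4 : ℝ) ^ n := by
      rw [pow_succ] at hk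
      have := mul_lt_mul_of_pos_right hk h4
      have e : e₀ * ((4 : ℝ) ^ n * 4)⁻¹ * (4 : ℝ) ^ n = e₀ * ((4 : ℝ) ^ n)⁻¹ * (4 : ℝ) ^ n / 4 := by field_simp
      linarith only [this, e]
    have e2 : e₀ * ((4 : ℝ) ^ n)⁻¹ * (4 : ℝ) ^ n = e₀ := by field_simp
    rw [e2] at this
    nlinarith only [this, he]
  · rw [klAnisoFamily, sum_bgmMultiplier]

/-- **The fat family vanishes at `t ≥ Λ_{n−1}`** (`1 ≤ n`): `bgmFatMultiplier … n ω k = 0`. [cite: BenfattoGiulianiMastropietro2006, §2.7 (2.66)] -/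
theorem bgmFatMultiplier_eq_zero_of_le (he : 0 < e₀) {n : ℕ} (hn : 1 ≤ n) (ω : Fin (sectorCount n)) (k : FreqMomentum L M)
    (hk : klScale e₀ (n - 1) ≤ Real.sqrt (matsubaraFreq β M k.1 ^ 2 + nambuXiCT L μ K k.2 ^ 2)) :
    bgmFatMultiplier L M e₀ β (nambuXiCT L μ K) n ω k = 0 := by
  have hz : (-(n : ℤ)) + 1 = -(((n - 1 : ℕ)) : ℤ) := by
    have : ((n - 1 : ℕ) : ℤ) = (n : ℤ) - 1 := by omega
    omega
  rw [bgmFatMultiplier, hz, gnScaleCutoff_eq_zero (by norm_num) he (by rwa [← klScale_eq_zpow e₀]), zero_mul, Complex.ofReal_zero]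

end Multipliers

/-! ## §2 The engine's covariances: the soft covariance is supported on `t < Λ_n` and is a slice -/

section Covariances

variable {L M : ℕ}

/-- **Below every Matsubara frequency the cutoff weight is `1`**: for `0 < Λₛ ≤ π/β` (`0 < β`), `w_{Λₛ}(k) = χ₂((ω_k² + e_K²)/Λₛ²) = 1` at
every `k` (since `|ω_k| ≥ π/β`). -/
theorem hubbardCutoffWeightCT_eq_one_of_le_pi_div {β : ℝ} (hβ : 0 < β) (μ : ℝ) (K : TrigPolyC4v) {Λs : ℝ} (hΛ : 0 < Λs)
    (hΛβ : Λs ≤ Real.pi / β) (k : FreqMomentum L M) : hubbardCutoffWeightCT L M β μ K Λs k = 1 := by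
  unfold hubbardCutoffWeightCT
  apply salmhoferCutoff_of_ge
  rw [le_div_iff₀ (by positivity), one_mul]
  have h1 : Λs ≤ |matsubaraFreq β M k.1| := hΛβ.trans (pi_div_le_abs_matsubaraFreq hβ k.1)
  have h2 : Λs ^ 2 ≤ matsubaraFreq β M k.1 ^ 2 := by
    rw [← sq_abs (matsubaraFreq β M k.1)]; exact pow_le_pow_left₀ hΛ.le h1 2
  nlinarith only [h2, sq_nonneg (nambuXiCT L μ K k.2)]

/-- **The soft covariance is a slice**: `klSoftCov n = C^K − C^K_{>Λ_n} = C^K_{(Λₛ, Λ_n]}` for every `0 < Λₛ ≤ π/β`. -/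
theorem klSoftCov_eq_hubbardCovSliceCT [NeZero M] {β : ℝ} (hβ : 0 < β) (μ : ℝ) (K : TrigPolyC4v) (n : ℕ) {Λs : ℝ} (hΛ : 0 < Λs)
    (hΛβ : Λs ≤ Real.pi / β) :
    klSoftCov L M β μ K n = hubbardCovSliceCT L M β μ 0 K Λs (klScale klE0 n) := by
  ext X Y
  simp only [klSoftCov, hubbardCovBelowCT, hubbardCovSliceCT, hubbardCovAboveCT, Matrix.sub_apply, Matrix.of_apply,
    hubbardCutoffWeightCT_eq_one_of_le_pi_div hβ μ K hΛ hΛβ]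
  norm_num

/-- **The soft covariance of the extended ladder**: `klSoftCov n = C^K_{(Λ_{n_β+1}, Λ_n]}` (`klBetaMin ≤ β`; `Λ_{n_β+1} < π/β`). -/
theorem klSoftCov_eq_sliceCT_nScales_succ [NeZero M] {β : ℝ} (hβ : klBetaMin ≤ β) (μ : ℝ) (K : TrigPolyC4v) (n : ℕ) :
    klSoftCov L M β μ K n = hubbardCovSliceCT L M β μ 0 K (klScale klE0 (nScales β + 1)) (klScale klE0 n) :=
  klSoftCov_eq_hubbardCovSliceCT (pos_of_klBetaMin_le hβ) μ K n (klth_klScale_pos _)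
    (klScale_nScales_succ_lt (pos_of_klBetaMin_le hβ)).le

/-- **The soft covariance has no entry with a leg at `t ≥ Λ_n`** (`t² = ω² + e_K²`; `0 < Λ_n`): the weight `1 − w_{Λ_n}` vanishes there and
`C^K` is diagonal in frequency–momentum. -/
theorem klSoftCov_apply_eq_zero_of_le (β μ : ℝ) (K : TrigPolyC4v) (n : ℕ) (X Y : HubbardFieldIdx L M)
    (hX : klScale klE0 n ^ 2 ≤ matsubaraFreq β M (momentumOf L M X).1 ^ 2 + nambuXiCT L μ K (momentumOf L M X).2 ^ 2) :
    klSoftCov L M β μ K n X Y = 0 := by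
  have hΛ := klth_klScale_pos n
  by_cases hXY : X.1 = Y.1
  · have hwX : hubbardCutoffWeightCT L M β μ K (klScale klE0 n) (momentumOf L M X) = 1 := by
      unfold hubbardCutoffWeightCT
      exact salmhoferCutoff_of_ge (by rw [le_div_iff₀ (by positivity)]; linarith)
    have hwY : hubbardCutoffWeightCT L M β μ K (klScale klE0 n) (momentumOf L M Y) = 1 := by
      have : momentumOf L M Y = momentumOf L M X := by simp only [momentumOf]; rw [hXY]
      rw [this, hwX]
    simp only [klSoftCov, hubbardCovBelowCT, hubbardCovAboveCT, Matrix.sub_apply, Matrix.of_apply, hwX, hwY]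
    norm_num
  · simp only [klSoftCov, hubbardCovBelowCT, hubbardCovAboveCT, Matrix.sub_apply, Matrix.of_apply,
      hubbardCovarianceCT_eq_zero_of_fst_ne (L := L) (M := M) β μ K hXY, mul_zero, sub_zero]

end Covariances

/-! ## §3 The `hsupp` door for the thin family -/

section Hsupp

variable {L M : ℕ} {e₀ : ℝ} (β μ : ℝ) (K : TrigPolyC4v)

/-- **Support inside the plateau gives `hsupp`**: if every nonzero kernel of `G` has all its legs at `t ≤ Λ_{n+1}`, then `G` satisfies the
support hypothesis of `hubbardSectorKernelNorm_effAction_le_of_sectorNorm` / `map_sectorSub_sectorPreimage` for `F = klAnisoFamily … e₀ n`.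
[cite: BenfattoGiulianiMastropietro2006, §2.5 (2.48)] -/
theorem hsupp_klAnisoFamily_of_support (he : 0 < e₀) (n : ℕ) (G : HubbardGrassmann L M)
    (hG : ∀ (m : ℕ) (X : Fin m → HubbardFieldIdx L M), kernel ℂ G m X ≠ 0 →
      ∀ i, Real.sqrt (matsubaraFreq β M (X i).1.1.1 ^ 2 + nambuXiCT L μ K (X i).1.1.2 ^ 2) ≤ klScale e₀ (n + 1)) :
    ∀ (m : ℕ) (X : Fin m → HubbardFieldIdx L M), kernel ℂ G m X ≠ 0 →
      ∀ i, ∑ ω, klAnisoFamily L M β μ K e₀ n ω (X i).1.1 = 1 :=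
  fun m X hX i => sum_klAnisoFamily_eq_one_of_le β μ K he n (X i).1.1 (hG m X hX i)

end Hsupp

end Summit.HubbardSuperconductivity.HubbardSuperconductivity.Theorems.KLRegimeWick

end
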